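import Summits.AtomisticToContinuum.Crystallization.Theses.PricedLinkCensus

/-!
# Sketch — crux `LocalToGlobal` (stmt-AtomisticToContinuum-14232), crux-ideate ideator 2 (gen 2)

First lemmas of the two idea cards of this seat, over existing declarations only:

* card `zoom-to-perfect-sea` — `RCdense` (density-gated relative coercivity at ONE global dilation)
  and the proved reduction `denseChargedEnergyGap_of_RCdense :
  TruncatedCensusGap → RCdense → DenseChargedEnergyGap` (the DENSE branch of the dichotomy closes
  from the census); the dilute branch's residues are stated as shapes (`PinningShape`).
* card `transplant-hospital` — `TransplantDomination` (consume the census on a free-size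
  transplant configuration `z`, charge transferred up to threshold-marginal sites) and the proved
  reduction `localToGlobal_of_transplantDomination : TransplantDomination → LocalToGlobal`.

Everything here elaborates against the route file; the two reductions are sorry-free.
-/

noncomputable section

open scoped BigOperators
open Literature.MathematicalPhysics.StatisticalMechanics Literature.Geometry.DiscreteGeometry
open Summit.AtomisticToContinuum.Crystallization.Theses.PricedLinkCensus

namespace Summit.AtomisticToContinuum.Crystallization.Cruxes.LocalToGlobal.IdeatorTwo

/-- Euclidean 3-space. -/
abbrev E3 := EuclideanSpace ℝ (Fin 3)

/-- The route's range-2 truncation (syntactically the lambda inlined in `TruncatedCensusGap`). -/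
def Vchi (r : ℝ) : ℝ := min 1 (max 0 (4 - 2 * r)) * lennardJones r

/-- `e* = ⨅_Q e_LJ(Q)`. -/
def eStar : ℝ := ⨅ Q : PeriodicConfiguration 3, Q.energyPerParticle lennardJones

/-- `e_χ* = ⨅_Q e_χ(Q)`. -/
def eChiStar : ℝ := ⨅ Q : PeriodicConfiguration 3, Q.energyPerParticle Vchi

/-- number of charged sites (not charge-free at tolerance `1/100`). -/
def chargedCount {N : ℕ} (y : Fin N → E3) : ℕ :=
  Nat.card {i : Fin N // ¬ IsChargeFree (1 / 100 : ℝ) y i}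

theorem truncatedCensusGap_iff' :
    TruncatedCensusGap ↔ ∃ κ : ℝ, 0 < κ ∧ ∀ (N : ℕ) (y : Fin N → E3), Function.Injective y →
      (N : ℝ) * eChiStar + κ * (chargedCount y : ℝ) ≤ interactionEnergy Vchi y := Iff.rfl

theorem chargedEnergyGap_iff' :
    ChargedEnergyGap ↔ ∃ κ C : ℝ, 0 < κ ∧ ∀ (N : ℕ) (y : Fin N → E3), Function.Injective y →
      (N : ℝ) * eStar + κ * (chargedCount y : ℝ) - C * (N : ℝ) ^ (2 / 3 : ℝ) ≤
        interactionEnergy lennardJones y := Iff.rfl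

/-- Link charge is dilation-invariant, hence so is the charged count. -/
theorem chargedCount_smul {N : ℕ} {lam : ℝ} (h : lam ≠ 0) (y : Fin N → E3) :
    chargedCount (lam • y) = chargedCount y := by
  unfold chargedCount
  exact Nat.card_congr (Equiv.subtypeEquivRight fun i => not_congr (isChargeFree_smul_iff h _ y i))

theorem injective_smul {N : ℕ} {lam : ℝ} (h : lam ≠ 0) {y : Fin N → E3}
    (hy : Function.Injective y) : Function.Injective (lam • y) := by
  intro i j hij
  apply hy
  have : lam • y i = lam • y j := hij
  exact smul_right_injective E3 h this

/-! ## Card `zoom-to-perfect-sea`: the dense branch -/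

/-- `ChargedEnergyGap` restricted to configurations whose charge is GLOBALLY dense
(`#charged ≥ c₀ N`), for every density threshold `c₀ > 0` (constants may depend on `c₀`). -/
def DenseChargedEnergyGap : Prop :=
  ∀ c₀ : ℝ, 0 < c₀ → ∃ κ C : ℝ, 0 < κ ∧ ∀ (N : ℕ) (y : Fin N → E3), Function.Injective y →
    c₀ * (N : ℝ) ≤ chargedCount y →
      (N : ℝ) * eStar + κ * (chargedCount y : ℝ) - C * (N : ℝ) ^ (2 / 3 : ℝ) ≤
        interactionEnergy lennardJones y

/-- **Density-gated relative coercivity (first lemma of card `zoom-to-perfect-sea`).**  For every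
charge-density threshold `c₀ > 0` there are `θ(c₀) > 0`, one GLOBAL dilation `lam` and `C` with
`E_LJ(y) − N e* ≥ θ · (E_χ(lam • y) − N e_χ*) − C N^{2/3}` for every injective `y` carrying at least
`c₀ N` charged sites.  The density hypothesis is what the refuted `RelativeCoercivity`
(card scale-free-shape-transfer; Disproof §6) lacks: the c/a-sliver `m_χ · N` of the dilated census
is now paid by the charge's OWN Lennard-Jones cost (`θ(c₀) ≲ κ_V c₀ / m_χ`), and twist-wall laminates
of wall spacing `ℓ` enter only with `ℓ ≲ C(θ_m)/c₀`, where their wall energy per CHARGED site is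
bounded below. -/
def RCdense : Prop :=
  ∀ c₀ : ℝ, 0 < c₀ → ∃ θ lam C : ℝ, 0 < θ ∧ 0 < lam ∧
    ∀ (N : ℕ) (y : Fin N → E3), Function.Injective y → c₀ * (N : ℝ) ≤ chargedCount y →
      θ * (interactionEnergy Vchi (lam • y) - (N : ℝ) * eChiStar) - C * (N : ℝ) ^ (2 / 3 : ℝ) ≤
        interactionEnergy lennardJones y - (N : ℝ) * eStar

/-- The dense branch closes from the census: `TruncatedCensusGap ∧ RCdense ⇒ DenseChargedEnergyGap`
(with `κ' = θ(c₀) κ`). -/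
theorem denseChargedEnergyGap_of_RCdense (hA : TruncatedCensusGap) (h : RCdense) :
    DenseChargedEnergyGap := by
  intro c₀ hc₀
  obtain ⟨θ, lam, C, hθ, hlam, H⟩ := h c₀ hc₀
  obtain ⟨κ, hκ, hAκ⟩ := hA
  refine ⟨θ * κ, C, mul_pos hθ hκ, fun N y hy hd => ?_⟩
  have h1 := H N y hy hd
  have h2 := hAκ N (lam • y) (injective_smul hlam.ne' hy)
  change (N : ℝ) * eChiStar + κ * (chargedCount (lam • y) : ℝ) ≤ interactionEnergy Vchi (lam • y)
    at h2
  rw [chargedCount_smul hlam.ne'] at h2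
  have h3 : θ * (κ * (chargedCount y : ℝ)) ≤
      θ * (interactionEnergy Vchi (lam • y) - (N : ℝ) * eChiStar) :=
    mul_le_mul_of_nonneg_left (by linarith) hθ.le
  have h4 : θ * κ * (chargedCount y : ℝ) = θ * (κ * (chargedCount y : ℝ)) := by ring
  linarith

/-! ## Card `transplant-hospital`: consume the census on a free-size transplant -/

/-- Number of THRESHOLD-MARGINAL sites of `y` at relative width `α`: sites `i` having two sites
`j ≠ k` in their `3·nn_i` window whose distance ratio `dist(j,k)/min(nn_j, nn_k)` lies within a
factor `(1 ± α)` of the bond threshold `1 + 1/100`.  (Only these sites can change charge status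
under a `(1 ± α)`-quasi-similar gauge; they carry a genuine `≈ 1 %` local bond strain.) -/
def marginalCount {N : ℕ} (α : ℝ) (y : Fin N → E3) : ℕ :=
  Nat.card {i : Fin N // ∃ j k : Fin N, j ≠ k ∧ dist (y i) (y j) ≤ 3 * nearestDist y i ∧
    dist (y i) (y k) ≤ 3 * nearestDist y i ∧
    (1 + 1 / 100) * (1 - α) * min (nearestDist y j) (nearestDist y k) < dist (y j) (y k) ∧
    dist (y j) (y k) ≤ (1 + 1 / 100) * (1 + α) * min (nearestDist y j) (nearestDist y k)}

/-- **Transplant domination (first lemma of card `transplant-hospital`).**  There are `θ, κ_m,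
α > 0` and `C` such that every injective `y` admits an injective TRANSPLANT configuration `z`
of FREE size `M` (intended: one pristine `V_χ`-crystal host carrying gauged copies of `y`'s charged
units with their charge-free collars; the charge-free bulk of `y` is discarded) with
(i) charge transfer `#ch(y) ≤ #ch(z) + #marginal_α(y)` and (ii) energy domination
`θ (E_χ(z) − M e_χ*) + κ_m #marginal_α(y) ≤ E_LJ(y) − N e* + C N^{2/3}`.  Unlike the refuted
image-type transfers (`RelativeCoercivity`, `CutAndAdaptDomination`, Claim G) the image is NOT a
gauge of all of `y`: per-site slivers live on codimension-one collars only. -/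
def TransplantDomination : Prop :=
  ∃ θ C κm α : ℝ, 0 < θ ∧ 0 < κm ∧ 0 < α ∧ ∀ (N : ℕ) (y : Fin N → E3), Function.Injective y →
    ∃ (M : ℕ) (z : Fin M → E3), Function.Injective z ∧
      (chargedCount y : ℝ) ≤ chargedCount z + marginalCount α y ∧
      θ * (interactionEnergy Vchi z - (M : ℝ) * eChiStar) + κm * (marginalCount α y : ℝ) ≤
        interactionEnergy lennardJones y - (N : ℝ) * eStar + C * (N : ℝ) ^ (2 / 3 : ℝ)

/-- `TransplantDomination ⇒ LocalToGlobal` (with `κ' = min (θ κ) κ_m`): the census is consumed on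
the transplant `z`, never on `y` or a gauge image of `y`. -/
theorem localToGlobal_of_transplantDomination (h : TransplantDomination) : LocalToGlobal := by
  intro hA
  obtain ⟨κ, hκ, hAκ⟩ := hA
  obtain ⟨θ, C, κm, α, hθ, hκm, _hα, H⟩ := h
  refine ⟨min (θ * κ) κm, C, lt_min (mul_pos hθ hκ) hκm, fun N y hy => ?_⟩
  obtain ⟨M, z, hz, hch, hE⟩ := H N y hy
  have h2 := hAκ M z hz
  change (M : ℝ) * eChiStar + κ * (chargedCount z : ℝ) ≤ interactionEnergy Vchi z at h2
  change (N : ℝ) * eStar + min (θ * κ) κm * (chargedCount y : ℝ) - C * (N : ℝ) ^ (2 / 3 : ℝ) ≤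
    interactionEnergy lennardJones y
  have hm1 : min (θ * κ) κm ≤ θ * κ := min_le_left _ _
  have hm2 : min (θ * κ) κm ≤ κm := min_le_right _ _
  have hm0 : 0 ≤ min (θ * κ) κm := (lt_min (mul_pos hθ hκ) hκm).le
  have hz0 : (0 : ℝ) ≤ chargedCount z := Nat.cast_nonneg _
  have hmg0 : (0 : ℝ) ≤ marginalCount α y := Nat.cast_nonneg _
  have s1 : min (θ * κ) κm * (chargedCount y : ℝ) ≤
      min (θ * κ) κm * ((chargedCount z : ℝ) + marginalCount α y) :=
    mul_le_mul_of_nonneg_left hch hm0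
  have s2 : min (θ * κ) κm * ((chargedCount z : ℝ) + marginalCount α y) ≤
      θ * κ * (chargedCount z : ℝ) + κm * (marginalCount α y : ℝ) := by
    rw [mul_add]
    exact add_le_add (mul_le_mul_of_nonneg_right hm1 hz0) (mul_le_mul_of_nonneg_right hm2 hmg0)
  have s3 : θ * (κ * (chargedCount z : ℝ)) ≤ θ * (interactionEnergy Vchi z - (M : ℝ) * eChiStar) :=
    mul_le_mul_of_nonneg_left (by linarith) hθ.le
  have s4 : θ * κ * (chargedCount z : ℝ) = θ * (κ * (chargedCount z : ℝ)) := by ring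
  linarith

/-! ## Shapes for the dilute branch / the pinning step (not proved here)

`PinningShape P`: the census pins its own constant — together with a χ-side charted Cauchy–Born
inequality with LINEAR NEGATIVE defect price relative to an explicit periodic `P` (intended:
`hcpPeriodicConfiguration` at the `V_χ`-relaxed `(a_χ, c_χ)`), `TruncatedCensusGap` forces
`e_χ* = e_χ(P)` (convex combination of the two inequalities along a near-minimising sequence).
This is what lets a transplant HOST contribute zero bulk excess. -/

/-- χ-side charted Cauchy–Born with a linear negative defect price, finite form. -/
def ChartedCauchyBornChi (P : PeriodicConfiguration 3) : Prop :=
  ∃ C : ℝ, ∀ (N : ℕ) (y : Fin N → E3), Function.Injective y →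
    (N : ℝ) * P.energyPerParticle Vchi - C * (chargedCount y : ℝ) ≤ interactionEnergy Vchi y

/-- Block (thermodynamic-limit) upper bound for the finite-range `V_χ`: every periodic `Q` is
approached from above by finite blocks. -/
def BlockLimitChi : Prop :=
  ∀ Q : PeriodicConfiguration 3, ∀ ε : ℝ, 0 < ε → ∃ (N : ℕ) (y : Fin N → E3),
    Function.Injective y ∧ 0 < N ∧ interactionEnergy Vchi y ≤ (N : ℝ) * (Q.energyPerParticle Vchi + ε)

/-- The pinning statement (shape). -/
def PinningShape (P : PeriodicConfiguration 3) : Prop :=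
  TruncatedCensusGap → ChartedCauchyBornChi P → BlockLimitChi →
    BddBelow (Set.range fun Q : PeriodicConfiguration 3 => Q.energyPerParticle Vchi) →
      eChiStar = P.energyPerParticle Vchi

end Summit.AtomisticToContinuum.Crystallization.Cruxes.LocalToGlobal.IdeatorTwo

end
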